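import Summits.ABC.IUTFork.Thm311RealArchInd1StripSignature
import Summits.ABC.IUTFork.Thm311RealArchInd2PrintCard
import HarnessLib

/-!
# [IUTchIII] Theorem 3.11 (i) at `v ∈ 𝕍^arc`: the CARDINALITY CENSUS of the three typed strip/Ism slots at an
# archimedean place — Dupuy–Hilado strip `1` < print strip `2` = typed (Ind2) `2` < print (Ind2) `4` (complex place)

PROOF-ONLY companion (no `def`, no `Prop` fact, no instance) by abc-iut-w4-d001 (gen 6; row «R9-ARCH», part 4) of
`Thm311RealArchInd1StripCarrier.lean` (print's archimedean (Ind1) strip part `Real.ind1StripArch w = {1, −1}`) and of this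
seat's gen-2 card `Thm311RealArchInd2PrintCard.lean` (`ncard_ismDH_inl = 2`, `ncard_ismPrintArch_of_isComplex = 4`);
TAKES NO SIDE on [IUTchIII] Cor. 3.12. For the referees' «typed vs print» census of the (Ind1)/(Ind2) slots of the real
instantiation of [IUTchIII] Thm. 3.11 (i) at ONE archimedean place `w` of `F` (numbers, not adjectives):

* `Real.ncard_stripAutDH_inl` — Dupuy–Hilado's trivialised strip slot has ONE element (`{1}`, DH §4.7);
* `Real.ncard_ind1StripArch` — print's archimedean (Ind1) strip part has TWO (`{1, −1}`), at every infinite place;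
* `Real.ncard_stripPrintAll_inl` — so does the every-place print strip slot at `inl w`;
* `Real.ncard_ind1StripArch_eq_ncard_ismDH` — print strip `=` typed (Ind2) (`2 = 2`: the two SETS coincide,
  `ind1StripArch_eq_ismDH`);
* `Real.ncard_stripAutDH_lt_ncard_ind1StripArch` (`1 < 2`) and, at a COMPLEX place,
  `Real.ncard_ind1StripArch_lt_ncard_ismPrintArch` (`2 < 4`): the chain DH-strip ⊊ print-strip = typed-Ism ⊊ print-Ism;
  at a real place (none under print's `√−1 ∈ F`) print's (Ind2) also has two elements (`ncard_ismPrintArch_of_not_isComplex`),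
  so there print-strip = typed-Ism = print-Ism as sets (`Real.ind1StripArch_eq_ismPrintArch_of_not_isComplex`).

[claim: Mochizuki2012, status: disputed] for the quotations behind the slots ([IUTchIII] Thm. 3.11 (i) p. 154; [IUTchI]
Def. 4.1 (iii) p. 96; [AbsTopIII] Prop. 5.8 (iv)(v) p. 140); [cite: DupuyHilado2025, §4.7]. typed ≠ proved;
instantiated ≠ endorsed; nothing here bears on the truth of [IUTchIII] Cor. 3.12.
-/

set_option autoImplicit false

noncomputable section

namespace Summit.ABC.IUTFork.Thm311.Real

open NumberField

variable {F : Type} [Field F] [NumberField F] (logv : PadicLogs F)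

/-- Dupuy–Hilado's trivialised strip slot at an archimedean place has ONE element. [cite: DupuyHilado2025, §4.7] -/
theorem ncard_stripAutDH_inl (w : InfinitePlace F) : (stripAutDH (.inl w : Place F)).ncard = 1 :=
  Set.ncard_singleton _

/-- **Print's archimedean (Ind1) strip part has exactly TWO elements** (`{1, −1}`). [claim: Mochizuki2012, status: disputed] -/
theorem ncard_ind1StripArch (w : InfinitePlace F) : (ind1StripArch w).ncard = 2 := by
  rw [ind1StripArch_eq, Set.ncard_insert_of_notMem (by rw [Set.mem_singleton_iff]; exact refl_ne_neg_carrier w),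
    Set.ncard_singleton]

/-- The every-place print strip slot at an archimedean place has two elements. [claim: Mochizuki2012, status: disputed] -/
theorem ncard_stripPrintAll_inl (w : InfinitePlace F) : (stripPrintAll logv (.inl w : Place F)).ncard = 2 :=
  ncard_ind1StripArch w

/-- Print's archimedean strip part and the typed archimedean (Ind2) slot have the same number of elements (they are
the same set). [claim: Mochizuki2012, status: disputed] -/
theorem ncard_ind1StripArch_eq_ncard_ismDH (w : InfinitePlace F) :
    (ind1StripArch w).ncard = (ismDH logv (.inl w : Place F)).ncard := by
  rw [ind1StripArch_eq_ismDH logv]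

/-- `1 < 2`: DH's strip slot is strictly smaller than print's at every archimedean place. [claim: Mochizuki2012, status: disputed] -/
theorem ncard_stripAutDH_lt_ncard_ind1StripArch (w : InfinitePlace F) :
    (stripAutDH (.inl w : Place F)).ncard < (ind1StripArch w).ncard := by
  rw [ncard_stripAutDH_inl, ncard_ind1StripArch]
  norm_num

/-- `2 < 4`: at a COMPLEX place print's strip part is strictly smaller than print's (Ind2) (the Klein four-group).
[claim: Mochizuki2012, status: disputed] -/
theorem ncard_ind1StripArch_lt_ncard_ismPrintArch {w : InfinitePlace F} (hw : w.IsComplex) :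
    (ind1StripArch w).ncard < (ismPrintArch logv (.inl w : Place F)).ncard := by
  rw [ncard_ind1StripArch, ncard_ismPrintArch_of_isComplex logv hw]
  norm_num

/-- At a real place (`K_w = ℝ`; none occurs under print's running hypothesis `√−1 ∈ F`) print's strip part, the typed
(Ind2) slot and print's (Ind2) slot all coincide as sets. [claim: Mochizuki2012, status: disputed] -/
theorem ind1StripArch_eq_ismPrintArch_of_not_isComplex {w : InfinitePlace F} (hw : ¬ w.IsComplex) :
    ind1StripArch w = ismPrintArch logv (.inl w : Place F) := by
  rw [ind1StripArch_eq_ismDH logv, ismPrintArch_eq_ismDH_of_not_isComplex logv hw]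

/-- The census in one line: `(1, 2, 2, 4)` = (DH strip, print strip, typed Ism, print Ism) at a complex place.
[claim: Mochizuki2012, status: disputed] -/
theorem arch_slot_census_of_isComplex {w : InfinitePlace F} (hw : w.IsComplex) :
    (stripAutDH (.inl w : Place F)).ncard = 1 ∧ (ind1StripArch w).ncard = 2 ∧
      (ismDH logv (.inl w : Place F)).ncard = 2 ∧ (ismPrintArch logv (.inl w : Place F)).ncard = 4 :=
  ⟨ncard_stripAutDH_inl w, ncard_ind1StripArch w, ncard_ismDH_inl logv w, ncard_ismPrintArch_of_isComplex logv hw⟩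

end Summit.ABC.IUTFork.Thm311.Real

end
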